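import Mathlib
import HarnessLib
import HarnessLib.Audit
import Summits.CriticalPhenomena.Statement
import Literature.Analysis.FunctionSpaces.PoissonPointProcess
import Literature.Analysis.FunctionSpaces.PoissonPointProcessExistence
import Literature.Probability.RandomPlanarGeometry.HexSAW
import HarnessLib.Audit.Status.Attr

/-!
Route: SAWPoissonSubstrate

DORMANT since 2026-08-23T07:24:37Z (reconciler: no traction for 6 d (last activity item-evidence-added at 2026-08-17T07:23:58Z); parked, not closed — `ledger route dormant route-CriticalPhenomena-SAWPoissonSubstrate --off` to reactivate) — unstaffed, not closed; items shared with open routes are served there. `ledger route dormant <id> --off` reactivates.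

# Route SAWPoissonSubstrate — the annealed critical SAW on the Poisson honeycomb as transfer partner
for δℤ² — PVConvergence (black box) ∧ SubstrateUniversality; transfer half of the split of
SAWPoissonHoneycomb

It suffices to show X₂ = (PV) ∧ (U) — the TRANSFER HALF of the thesis of route SAWPoissonHoneycomb
(card
poisson-honeycomb-density-gradient), split off on the gate's crux-cap route-choice of 2026-08-16 (9
cruxes after the auto-crux
backfill; option "split the thesis into two routes"). (PV) PVConvergence — the ANNEALED critical
self-avoiding walk on the POISSON
HONEYCOMB (Voronoi-vertex graph of a Poisson process of intensity δ⁻² on ℂ, weight x_c^(#vertices)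
with x_c = 1/μ_PV, walk between the
domain vertices nearest to a and b, environment averaged) converges in law on CurveClass ℂ, in every
Dobrushin domain, to chordal
SLE_(8/3) — is carried here as ONE black-box crux (stmt-CriticalPhenomena-6943; it is decomposed
crux-first in the sibling route
SAWPoissonHoneycomb: DensityUniversality, QuenchedLimit, PVTightSimple, MetricBlindness,
LSWHullCharacterisation, PVLimitIdentification).
(U) SubstrateUniversality — in every Dobrushin domain and for every δℤ² endpoint approximation the
δℤ² critical SAW law
(Literature.Probability.RandomPlanarGeometry.SAW.law) and the annealed Poisson-honeycomb law at
intensity δ⁻² are asymptotically equal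
on bounded continuous test functions — is THIS route's content (stmt-CriticalPhenomena-6937): the
refutable, asymptotic-equality form of
the transfer, staffed on its own, while the sibling keeps only the implicational bridge PVTransfer.
The two-ε transfer that turns (PV) ∧ (U) into the conjunct is proved INSIDE the deciding theorem
(rev 1). Both cruxes are the
sibling's EXISTING items re-asked verbatim (dedup by signature): no new mathematical statement
enters the ledger through this route.
Lean: `(∀ (Pois : MeasureTheory.Measure ℂ → MeasureTheory.Measure
(Literature.Analysis.FunctionSpaces.PointConfig ℂ)), (∀ ν : MeasureTheory.Measure ℂ,
MeasureTheory.IsLocallyFiniteMeasure ν → (∀ z : ℂ, ν {z} = 0) →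
Literature.Analysis.FunctionSpaces.IsPoissonPointProcess ν (Pois ν)) → let S :
Literature.Analysis.FunctionSpaces.PointConfig ℂ → ℂ → Set ℂ := fun ω c => (ω : Set ℂ) ∩
Metric.sphere c (Metric.infDist c (ω : Set ℂ)); let vor :
Literature.Analysis.FunctionSpaces.PointConfig ℂ → SimpleGraph ℂ := fun ω => SimpleGraph.fromRel fun
c c' => 3 ≤ (S ω c).encard ∧ 3 ≤ (S ω c').encard ∧ (S ω c ∩ S ω c').encard = 2; let μ : ENNReal :=
essSup (fun ω => Filter.limsup (fun n : ℕ => (⨆ c : Metric.closedBall (0 : ℂ) 1,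
(Literature.Probability.RandomPlanarGeometry.SAW.sawCount (vor ω) (c : ℂ) n : ENNReal)) ^ (1 / (n :
ℝ))) Filter.atTop) (Pois MeasureTheory.volume); let xc : ℝ := (μ.toReal)⁻¹; let near :
Literature.Analysis.FunctionSpaces.PointConfig ℂ → Set ℂ → ℂ → ℂ := fun ω Ω z => Classical.epsilon
fun v : ℂ => v ∈ Literature.Probability.RandomPlanarGeometry.SAW.embMeshDomain (vor ω) id Ω 1 ∧ ∀ w
∈ Literature.Probability.RandomPlanarGeometry.SAW.embMeshDomain (vor ω) id Ω 1, dist v z ≤ dist w z;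
let intens : (ℂ → ℝ) → ℝ → MeasureTheory.Measure ℂ := fun ρ δ => ENNReal.ofReal (δ⁻¹ ^ 2) •
MeasureTheory.volume.withDensity fun z => ENNReal.ofReal (ρ z); let qlaw :
Literature.Probability.RandomPlanarGeometry.DobrushinDomain →
Literature.Analysis.FunctionSpaces.PointConfig ℂ → MeasureTheory.Measure
(Literature.Probability.RandomPlanarGeometry.CurveClass ℂ) := fun D ω =>
(Literature.Probability.RandomPlanarGeometry.SAW.embLaw (vor ω) id D.carrier 1 xc (near ω D.carrier
(D.pt 0)) (near ω D.carrier (D.pt 1))).map fun γ => γ.curve; let Q : (ℂ → ℝ) →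
Literature.Probability.RandomPlanarGeometry.DobrushinDomain → ℝ → MeasureTheory.Measure
(Literature.Probability.RandomPlanarGeometry.CurveClass ℂ) := fun ρ D δ => (Pois (intens ρ δ)).bind
(qlaw D); ∀ D : Literature.Probability.RandomPlanarGeometry.DobrushinDomain, ∃ Γ : (NNReal → ℝ) →
Literature.Probability.RandomPlanarGeometry.CurveClass ℂ,
Literature.Probability.RandomPlanarGeometry.IsSLECurve ((8 : NNReal) / 3) D Γ ∧
Literature.Probability.RandomPlanarGeometry.TendstoLaw (fun (_ : ℝ) (x :
Literature.Probability.RandomPlanarGeometry.CurveClass ℂ) => x) (Q (fun _ => 1) D) Γ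
Literature.Probability.Process.preWienerMeasure) ∧ (∀ (Pois : MeasureTheory.Measure ℂ →
MeasureTheory.Measure (Literature.Analysis.FunctionSpaces.PointConfig ℂ)), (∀ ν :
MeasureTheory.Measure ℂ, MeasureTheory.IsLocallyFiniteMeasure ν → (∀ z : ℂ, ν {z} = 0) →
Literature.Analysis.FunctionSpaces.IsPoissonPointProcess ν (Pois ν)) → let S :
Literature.Analysis.FunctionSpaces.PointConfig ℂ → ℂ → Set ℂ := fun ω c => (ω : Set ℂ) ∩
Metric.sphere c (Metric.infDist c (ω : Set ℂ)); let vor :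
Literature.Analysis.FunctionSpaces.PointConfig ℂ → SimpleGraph ℂ := fun ω => SimpleGraph.fromRel fun
c c' => 3 ≤ (S ω c).encard ∧ 3 ≤ (S ω c').encard ∧ (S ω c ∩ S ω c').encard = 2; let μ : ENNReal :=
essSup (fun ω => Filter.limsup (fun n : ℕ => (⨆ c : Metric.closedBall (0 : ℂ) 1,
(Literature.Probability.RandomPlanarGeometry.SAW.sawCount (vor ω) (c : ℂ) n : ENNReal)) ^ (1 / (n :
ℝ))) Filter.atTop) (Pois MeasureTheory.volume); let xc : ℝ := (μ.toReal)⁻¹; let near :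
Literature.Analysis.FunctionSpaces.PointConfig ℂ → Set ℂ → ℂ → ℂ := fun ω Ω z => Classical.epsilon
fun v : ℂ => v ∈ Literature.Probability.RandomPlanarGeometry.SAW.embMeshDomain (vor ω) id Ω 1 ∧ ∀ w
∈ Literature.Probability.RandomPlanarGeometry.SAW.embMeshDomain (vor ω) id Ω 1, dist v z ≤ dist w z;
let intens : (ℂ → ℝ) → ℝ → MeasureTheory.Measure ℂ := fun ρ δ => ENNReal.ofReal (δ⁻¹ ^ 2) •
MeasureTheory.volume.withDensity fun z => ENNReal.ofReal (ρ z); let qlaw :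
Literature.Probability.RandomPlanarGeometry.DobrushinDomain →
Literature.Analysis.FunctionSpaces.PointConfig ℂ → MeasureTheory.Measure
(Literature.Probability.RandomPlanarGeometry.CurveClass ℂ) := fun D ω =>
(Literature.Probability.RandomPlanarGeometry.SAW.embLaw (vor ω) id D.carrier 1 xc (near ω D.carrier
(D.pt 0)) (near ω D.carrier (D.pt 1))).map fun γ => γ.curve; let Q : (ℂ → ℝ) →
Literature.Probability.RandomPlanarGeometry.DobrushinDomain → ℝ → MeasureTheory.Measure
(Literature.Probability.RandomPlanarGeometry.CurveClass ℂ) := fun ρ D δ => (Pois (intens ρ δ)).bind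
(qlaw D); ∀ (D : Literature.Probability.RandomPlanarGeometry.DobrushinDomain) (a b : ℝ →
Literature.Probability.LatticeModels.Site 2),
Literature.Probability.RandomPlanarGeometry.SAW.IsEndpointApprox D a b → ∀ f :
BoundedContinuousFunction (Literature.Probability.RandomPlanarGeometry.CurveClass ℂ) ℝ,
Filter.Tendsto (fun δ => (∫ γ, f γ.curve ∂(Literature.Probability.RandomPlanarGeometry.SAW.law
D.carrier δ (a δ) (b δ))) - ∫ x, f x ∂(Q (fun _ => 1) D δ)) (nhdsWithin 0 (Set.Ioi 0)) (nhds 0))`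

## Assembly
Pure two-ε logic plus one existence fact, PROVED INLINE in the deciding theorem (rev 1, crux-only):
fix a Dobrushin domain D and
an endpoint approximation (a_δ, b_δ); a Poisson functor Pois is obtained by `choose` from
Literature.Analysis.FunctionSpaces.existsUnique_isPoissonPointProcess_holds (Kingman existence +
Rényi uniqueness, proved in the
tree; junk value 0 off the locally-finite atomless class, where the items' hypothesis is void); (PV)
gives Γ with IsSLECurve (8/3) D Γ
and ∫ f dQ_D,δ → E f(Γ); (U) gives ∫ f∘curve dP^(ℤ²)_δ − ∫ f dQ_D,δ → 0; Tendsto.add and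
`sub_add_cancel`. The AEMeasurable clause of
ConvergesInLawToSLE is Literature.Probability.RandomPlanarGeometry.SAW.aemeasurable_curve. Deciding
theorem:
`closes (hU : SubstrateUniversality) (hPV : PVConvergence) : SAWScalingLimit` — binders = the two
cruxes, nothing else. The frame item
Assembly (stmt-CriticalPhenomena-16012; = the sibling's AssemblyViaTransfer stmt-6945 up to Iff.rfl,
whose attached candidate proof
AssemblyVT.lean proves it verbatim) stays as the route's optional assembly statement, NOT a
hypothesis of `closes`; provable now.

Rationale: WHY THIS LINE. The conjunct lives on δℤ², where no integrable or exactly covariant structure is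
known; the sibling route manufactures exact
conformal covariance on a different substrate (the Poisson honeycomb: SO(2) and dilations exact in
law, Möbius covariance by the
Kingman mapping theorem plus Benjamini–Schramm density invariance, BenjaminiSchramm1998,
book:bollobas2006-percolation p.264) and
must then TRANSFER the identified limit to δℤ². That transfer is a universality statement of the
same status as the retired
SAWHexUniversality.LatticeUniversality (hexagonal → square; Glazman–Manolescu arXiv:1708.00395 for
what Yang–Baxter technology gives
SAW) and as the HexTransfer tail cruxes of SAWDefectDecoherence / SAWPhaseRetrieval /
SAWWindingAlias / SAWDevelopingMap, here in its
mildest geometric form: Euclidean, isotropic in law, short-range connectivity disorder, no KPZ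
(contrast SAWQuantumGravity's
EnvironmentRemoval) — but with NO mechanism offered yet (LawlerSchrammWerner2004SAW Prediction 1 is
silent on substrates;
KennedyLawler2013 and GwynneMiller2021SAW are the nearest transfer-type results, for lattice effects
at the boundary and for SAW on
random planar maps respectively). Imported areas: none beyond the sibling's stochastic geometry; the
route exists so that (U) is
attacked and REFUTED OR PROVED as an equality of laws (a refutation with (PV) standing is first-rate
evidence of non-universality of
the planar SAW across substrates), which the implicational bridge of the sibling cannot offer (cf.
Theorems/HexTransfer/Negative:
an implication into the conjunct is irrefutable short of refuting the conjunct). What no other open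
route does: every other
SAWScalingLimit route works on δℤ² or on the hexagonal lattice; this is the only comparison family
that is Euclidean-random.

RANKED CRUXES. #2 SubstrateUniversality (crux) — (U, card r5; = stmt-CriticalPhenomena-6937 of the
sibling, re-asked verbatim) for every Dobrushin domain and every δℤ² endpoint approximation
(Literature.Probability.RandomPlanarGeometry.SAW.IsEndpointApprox), the difference of the test
integrals of a bounded continuous f : CurveClass ℂ → ℝ under the δℤ² critical SAW law and under the
annealed Poisson-honeycomb law at intensity δ⁻² (density 1) tends to 0 as δ → 0+; all
Poisson–Voronoi objects typed inline over Literature.Analysis.FunctionSpaces.IsPoissonPointProcess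
and Literature.Probability.RandomPlanarGeometry.SAW.embLaw, a Poisson functor Pois being the leading
hypothesis. [difficulty: open-problem] (why it might fail: No mechanism offered: the generic δℤ² ↔
other-substrate universality gap (status of the retired SAWHexUniversality.LatticeUniversality);
Beffara's embedding-modulus caveat sits here in full for ℤ²; the typed asymptotic equality also
presumes tightness of BOTH families.) [Beffara2008, KennedyLawler2013, GwynneMiller2021SAW,
LawlerSchrammWerner2004SAW, GlazmanManolescu2019, arXiv:1708.00395]
#3 PVConvergence (crux) — (PV; = stmt-CriticalPhenomena-6943 of the sibling, re-asked verbatim;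
there a support derived by PVLimitIdentification, here the black-box crux) for every Poisson functor
Pois and every Dobrushin domain D there is a chordal SLE_(8/3) random curve Γ in D such that the
annealed critical Poisson-honeycomb SAW law Q_D,δ at intensity δ⁻² converges in law (TendstoLaw,
identity variable on CurveClass ℂ, test functions bounded continuous) to Γ under the pre-Wiener
measure as δ → 0+. [difficulty: open-problem] (why it might fail: It IS "SLE(8/3) for the annealed
critical SAW on the Poisson honeycomb" — open; any of the sibling's DensityUniversality /
QuenchedLimit / PVTightSimple / MetricBlindness may fail (Harris-relevance of point disorder,
quenched ≠ annealed, 1/μ_PV not critical for confined walks).) [LawlerSchrammWerner2004SAW,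
BenjaminiSchramm1998, book:bollobas2006-percolation p.264, BarghathiVojta2014,
route-CriticalPhenomena-SAWPoissonHoneycomb]

TWO-LAYER PLAN. Nothing is filed now. Foreseen once a mechanism for (U) is chosen:
SubstrateUniversality ⇐ UTight → UAvoidance → SubstrateUniversality,
with UTight = eventual tightness of BOTH families on CurveClass ℂ (the δℤ² side is the shared item
EventualTight,
stmt-CriticalPhenomena-1372, never the refuted all-δ form stmt-CriticalPhenomena-0772; the Poisson
side is the sibling's PVTightSimple)
and UAvoidance = equality of the δ → 0+ limits of the hull-avoidance probabilities P[range ⊆ cl D′]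
of the two families for hull
subdomains D′ (a π-system determining laws carried by simple chords, cf. AvoidanceDeterminesLaw
stmt-CriticalPhenomena-1373);
glue: portmanteau + the π-system uniqueness. A split of PVConvergence is NOT made here — it is the
sibling route.

KILL CRITERIA. ¬SubstrateUniversality with PVConvergence standing is non-universality of the planar
critical SAW between δℤ² and the Poisson
honeycomb: close --reason refuted:SubstrateUniversality (and record it as a barrier for every
substrate-transfer line).
¬PVConvergence (most plausibly through a refutation of the sibling's PVTightSimple: 1/μ_PV not
critical for confined walks, or a
disordered universality class via ¬QuenchedLimit) closes this route too unless the sibling pivots PV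
to a restated fugacity
(then re-ask the restated PV here by route edit). SAWScalingLimit proved by any sibling δℤ² route
supersedes this one
(close --reason superseded --by …); SubstrateUniversality proved makes PVConvergence — i.e. the
sibling — the whole game.

NOT DECOMPOSED YET. (U) entirely: no mechanism is chosen (candidates: a joint coupling of the two
walks through common hull-avoidance events; a
Kennedy–Lawler boundary-effect analysis for the endpoint layer; Yang–Baxter-free "soft" universality
via restriction + covariance
of BOTH limits, which would reduce (U) to conformal covariance of the δℤ² limit and is therefore not
cheaper). Bookkeeping shared
with the sibling and left to `--supports` lemmas: kernel AEMeasurability of ω ↦ quenched law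
(without it the bind Q is the zero
measure and (U) would assert that the δℤ² test integrals tend to 0 — false for f = 1, so (U) cannot
close vacuously), a.s.
constancy of μ_PV ∈ [1, 2], endpoint conventions (nearest largest-component vertex) and their
robustness.

CHEAPEST FALSIFIER. Exponents of the Poisson-honeycomb SAW by exact enumeration / flatPERM on a few
hundred sampled environments (one batched kit job;
not run from this compute-free planner seat): anything but ν = 3/4, γ = 43/32 kills
SubstrateUniversality (and the bearing of
PVConvergence on δℤ²) at once. Second cheapest: compare left-passage frequencies of the two walks in
a disc at δ, δ/2, δ/4 against
Schramm's SLE_(8/3) formula — a substrate-dependent discrepancy stable under refinement refutes (U).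
Lookup done: no SAW-on-Poisson–Voronoi
result (exponents or μ_PV) exists in the held literature or the galaxy corpora (searches below), so
no printed number settles it.

NUMBERS. μ(ℤ²) ∈ [2.6, 2.7] (LawlerSchrammWerner2004SAW §3.1; ≈ 2.638), x_c(ℤ²) = 1/μ; μ_PV ≤ 2
(a.s. trivalent Voronoi-vertex graph), so
x_c(PV) ≥ 1/2 — the two Gibbs weights are powers of different numbers, so (U) is necessarily
asymptotic, never an identity of
finite-volume weights (same remark as Theorems/HexTransfer/Negative §5 for the hexagonal case); SAW
exponents ν = 3/4, γ = 43/32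
(Nienhuis 1982); κ = 8/3, restriction exponent 5/8 (LawlerSchrammWerner2003Restriction Thm 6.1);
Voronoi vertex density = 2 × site
density; Harris counts dν = 3/2 < 2, (d+1)ν = 9/4 > 2 (BarghathiVojta2014).

DEFINITION REQUESTS. None new. The sibling's requests D1 PoissonVoronoiGraph and D2 PVSAWLaw (topic
Literature/Probability/RandomPlanarGeometry) would
shorten both shared statements identically; when they land, both routes restate together (shared
items).

Novelty: Searches (2026-08-16): `lit search --hybrid "self-avoiding walk universality lattice independence
scaling limit SLE(8/3)"` (8 held
books: Slade 2006, Grimmett 2006, Lawler 2005, Lyons–Peres 2016, … — universality discussed only as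
conjecture); `lit search --hybrid
"self-avoiding walk on random lattice Voronoi Delaunay quenched disorder critical exponents"` (8
held, none on Poisson–Voronoi
substrates: den Hollander 2009 random polymers, Guttmann polygons, Finch constants); `lit galaxy
search "self-avoiding walks on random
Voronoi Delaunay lattices" --star all` (0), `"self-avoiding walks on random lattices" --star all`
(1, irrelevant), `"universality
self-avoiding walk" --star pdf` (0); `lit frontier CriticalPhenomena --since 2020` (30 newest
descendants, none Poisson–Voronoi +
SAW); `lit bridges CriticalPhenomena --cross any` (noise); `ledger negatives --problem
CriticalPhenomena` (10 entries, none a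
transfer statement); the sibling's searches of 2026-08-15 (BS98 / Bollobás–Riordan pp.256–268 read;
zbMATH 0 hits for SAW on
Voronoi). Ledger: SAWHexUniversality (retired not-a-thesis) LatticeUniversality
stmt-CriticalPhenomena-0807 and the HexTransfer tail
crux stmt-CriticalPhenomena-14221 are the in-house precedents of a transfer crux.
Nearest prior art found: BenjaminiSchramm1998 (doi:10.1007/s002200050443) with
book:bollobas2006-percolation p.264 (density
invariance ⇔ conformal invariance for Voronoi percolation — the substrate idea);
GlazmanManolescu2019 = arXiv:1708.00395 (t  [refs: 10.1007/s002200050443, 1708.00395, doi:10.1007/s002200050443, book:bollobas2006-percolation, BenjaminiSchramm1998, GlazmanManolescu2019, KennedyLawler2013]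

Barriers (technique_class: poisson-voronoi-substrate, universality-transfer): - technique_class: poisson-voronoi-substrate, universality-transfer
- Literature.Barriers.CriticalPhenomena.EmbeddingModulusUniqueness: it does not evade it — on the
δℤ² side of (U) Beffara's modulus uniqueness applies in full (an embedding-blind proof of (U) would
prove (U) for every shear of ℤ², which is false given (PV)); the bet is the one every δℤ² route
makes: a proof of (U) must use the square embedding (self-duality / the DKKMO-type rotation inputs),
and the route says so in the crux's why-line. On the Poisson side there is no competing modulus (a
linear image of the model is the ellipse-rule Voronoi model of another homogeneous Poisson process).
- Literature.Barriers.CriticalPhenomena.ScaleCovarianceNotMoebius: not invoked — no "scale +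
rotation ⇒ conformal" upgrade anywhere; conformal covariance is the sibling's business (exact
Poisson transport), and (U) transfers a law, not a symmetry.
- Literature.Barriers.CriticalPhenomena.SupercriticalSAWSpaceFilling: respected — both families sit
exactly at their critical fugacities (x_c(ℤ²) = 1/μ(ℤ²), x_c(PV) = 1/μ_PV), never perturbed; a
supercritical reading of 1/μ_PV for confined walks would surface as loss of simplicity in the
sibling's PVTightSimple and kill (PV), not fake (U).
- Literature.Barriers.CriticalPhenomena.SAWNotKineticallyGrown: inapplicable — Gibbs weights on both
substrates, nothing is grown.
- Literature.Barriers.CriticalPhenomena.NienhuisWeightsExcludeVertexSAW: inapplicable — no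
vertex/plaquette observab

History (route lifecycle, newest last):
- 2026-08-23T07:24:37Z · DORMANT — reconciler: no traction for 6 d (last activity item-evidence-added at 2026-08-17T07:23:58Z); parked, not closed — `ledger route dormant route-CriticalPhenomena- (operator:999:2891356)

sub-problem: SAWScalingLimit · status: dormant · opened planner-rchoice-CriticalPhenomena-SAWPoissonHo-11b4d6dd-0 2026-08-16T17:06:52Z · rev 3 · ledger route-CriticalPhenomena-SAWPoissonSubstrate
GENERATED by the gate from the ledger (D-0016/17). Provers cite these decls: `theorem foo : Summit.CriticalPhenomena.SAWScalingLimit.Theses.SAWPoissonSubstrate.<Decl> := …` in Summits/CriticalPhenomena/SAWScalingLimit/Theorems/<Name>.lean.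
-/

namespace Summit.CriticalPhenomena.SAWScalingLimit.Theses.SAWPoissonSubstrate

open scoped BigOperators Topology Manifold Classical MeasureTheory ProbabilityTheory Matrix InnerProductSpace ComplexConjugate ContinuousMap
open Filter Set Function TopologicalSpace MeasureTheory

attribute [summit_statement] _root_.SAWScalingLimit

/-- item stmt-CriticalPhenomena-6937 · crux · rank 2 · open · by planner
why it might fail: No mechanism offered: the generic δℤ² ↔ other-substrate universality gap (status of the retired SAWHexUniversality.LatticeUniversality); Beffara's embedding-modulus caveat sits here in full for ℤ²; the typed asymptotic equality also presumes tightness of BOTH families.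
sources: Beffara2008, KennedyLawler2013, GwynneMiller2021SAW, LawlerSchrammWerner2004SAW, GlazmanManolescu2019, arXiv:1708.00395
[crux] (U, card r5) for every Dobrushin domain and every δℤ² endpoint approximation
(Literature.Probability.RandomPlanarGeometry.SAW.IsEndpointApprox), the difference of test integrals
of the δℤ² critical SAW law and of the annealed Poisson-honeycomb law at intensity δ⁻² tends to 0 as
δ → 0+; the transfer crux shared in kind with SAWHexUniversality.LatticeUniversality and
SAWQuantumGravity's EnvironmentRemoval, here in its mildest form (Euclidean, isotropic, short-range
connectivity disorder, no KPZ). [difficulty: open-problem] -/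
@[route_item "route-CriticalPhenomena-SAWPoissonSubstrate", crux]
def SubstrateUniversality : Prop :=
  ∀ (Pois : MeasureTheory.Measure ℂ → MeasureTheory.Measure (Literature.Analysis.FunctionSpaces.PointConfig ℂ)), (∀ ν : MeasureTheory.Measure ℂ, MeasureTheory.IsLocallyFiniteMeasure ν → (∀ z : ℂ, ν {z} = 0) → Literature.Analysis.FunctionSpaces.IsPoissonPointProcess ν (Pois ν)) → let S : Literature.Analysis.FunctionSpaces.PointConfig ℂ → ℂ → Set ℂ := fun ω c => (ω : Set ℂ) ∩ Metric.sphere c (Metric.infDist c (ω : Set ℂ)); let vor : Literature.Analysis.FunctionSpaces.PointConfig ℂ → SimpleGraph ℂ := fun ω => SimpleGraph.fromRel fun c c' => 3 ≤ (S ω c).encard ∧ 3 ≤ (S ω c').encard ∧ (S ω c ∩ S ω c').encard = 2; let μ : ENNReal := essSup (fun ω => Filter.limsup (fun n : ℕ => (⨆ c : Metric.closedBall (0 : ℂ) 1, (Literature.Probability.RandomPlanarGeometry.SAW.sawCount (vor ω) (c : ℂ) n : ENNReal)) ^ (1 / (n : ℝ))) Filter.atTop) (Pois MeasureTheory.volume);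 let xc : ℝ := (μ.toReal)⁻¹; let near : Literature.Analysis.FunctionSpaces.PointConfig ℂ → Set ℂ → ℂ → ℂ := fun ω Ω z => Classical.epsilon fun v : ℂ => v ∈ Literature.Probability.RandomPlanarGeometry.SAW.embMeshDomain (vor ω) id Ω 1 ∧ ∀ w ∈ Literature.Probability.RandomPlanarGeometry.SAW.embMeshDomain (vor ω) id Ω 1, dist v z ≤ dist w z; let intens : (ℂ → ℝ) → ℝ → MeasureTheory.Measure ℂ := fun ρ δ => ENNReal.ofReal (δ⁻¹ ^ 2) • MeasureTheory.volume.withDensity fun z => ENNReal.ofReal (ρ z); let qlaw : Literature.Probability.RandomPlanarGeometry.DobrushinDomain → Literature.Analysis.FunctionSpaces.PointConfig ℂ → MeasureTheory.Measure (Literature.Probability.RandomPlanarGeometry.CurveClass ℂ) := fun D ω => (Literature.Probability.RandomPlanarGeometry.SAW.embLaw (vor ω) id D.carrier 1 xc (near ω D.carrier (D.pt 0)) (near ω D.carrier (D.pt 1))).map fun γ => γ.curve; let Q : (ℂ → ℝ) → Literature.Probability.RandomPlanarGeometry.DobrushinDomain → ℝ → MeasureTheory.Measure (Literature.Probability.RandomPlanarGeometry.CurveClass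 ℂ) := fun ρ D δ => (Pois (intens ρ δ)).bind (qlaw D); ∀ (D : Literature.Probability.RandomPlanarGeometry.DobrushinDomain) (a b : ℝ → Literature.Probability.LatticeModels.Site 2), Literature.Probability.RandomPlanarGeometry.SAW.IsEndpointApprox D a b → ∀ f : BoundedContinuousFunction (Literature.Probability.RandomPlanarGeometry.CurveClass ℂ) ℝ, Filter.Tendsto (fun δ => (∫ γ, f γ.curve ∂(Literature.Probability.RandomPlanarGeometry.SAW.law D.carrier δ (a δ) (b δ))) - ∫ x, f x ∂(Q (fun _ => 1) D δ)) (nhdsWithin 0 (Set.Ioi 0)) (nhds 0)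

/-- item stmt-CriticalPhenomena-6943 · crux · rank 3 · open · by planner
why it might fail: It IS "SLE(8/3) for the annealed critical SAW on the Poisson honeycomb" — open; any of the sibling's DensityUniversality / QuenchedLimit / PVTightSimple / MetricBlindness may fail (Harris-relevance of point disorder, quenched ≠ annealed, 1/μ_PV not critical for confined walks).
sources: LawlerSchrammWerner2004SAW, BenjaminiSchramm1998, book:bollobas2006-percolation p.264, BarghathiVojta2014, route-CriticalPhenomena-SAWPoissonHoneycomb
[support] (PV) the annealed critical Poisson-honeycomb SAW law in every Dobrushin domain converges
in law (TendstoLaw, identity variable) to a chordal SLE_(8/3) curve as δ → 0+; the comparison family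
Q that instantiates SAWHexUniversality.TransferShape (stmt-CriticalPhenomena-0802) for this route.
Closed via PVIdentification. [difficulty: open-problem] -/
@[route_item "route-CriticalPhenomena-SAWPoissonSubstrate", crux]
def PVConvergence : Prop :=
  ∀ (Pois : MeasureTheory.Measure ℂ → MeasureTheory.Measure (Literature.Analysis.FunctionSpaces.PointConfig ℂ)), (∀ ν : MeasureTheory.Measure ℂ, MeasureTheory.IsLocallyFiniteMeasure ν → (∀ z : ℂ, ν {z} = 0) → Literature.Analysis.FunctionSpaces.IsPoissonPointProcess ν (Pois ν)) → let S : Literature.Analysis.FunctionSpaces.PointConfig ℂ → ℂ → Set ℂ := fun ω c => (ω : Set ℂ) ∩ Metric.sphere c (Metric.infDist c (ω : Set ℂ)); let vor : Literature.Analysis.FunctionSpaces.PointConfig ℂ → SimpleGraph ℂ := fun ω => SimpleGraph.fromRel fun c c' => 3 ≤ (S ω c).encard ∧ 3 ≤ (S ω c').encard ∧ (S ω c ∩ S ω c').encard = 2; let μ : ENNReal := essSup (fun ω => Filter.limsup (fun n : ℕ => (⨆ c : Metric.closedBall (0 : ℂ) 1, (Literature.Probability.RandomPlanarGeometry.SAW.sawCount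 (vor ω) (c : ℂ) n : ENNReal)) ^ (1 / (n : ℝ))) Filter.atTop) (Pois MeasureTheory.volume); let xc : ℝ := (μ.toReal)⁻¹; let near : Literature.Analysis.FunctionSpaces.PointConfig ℂ → Set ℂ → ℂ → ℂ := fun ω Ω z => Classical.epsilon fun v : ℂ => v ∈ Literature.Probability.RandomPlanarGeometry.SAW.embMeshDomain (vor ω) id Ω 1 ∧ ∀ w ∈ Literature.Probability.RandomPlanarGeometry.SAW.embMeshDomain (vor ω) id Ω 1, dist v z ≤ dist w z; let intens : (ℂ → ℝ) → ℝ → MeasureTheory.Measure ℂ := fun ρ δ => ENNReal.ofReal (δ⁻¹ ^ 2) • MeasureTheory.volume.withDensity fun z => ENNReal.ofReal (ρ z); let qlaw : Literature.Probability.RandomPlanarGeometry.DobrushinDomain → Literature.Analysis.FunctionSpaces.PointConfig ℂ → MeasureTheory.Measure (Literature.Probability.RandomPlanarGeometry.CurveClass ℂ) := fun D ω => (Literature.Probability.RandomPlanarGeometry.SAW.embLaw (vor ω) id D.carrier 1 xc (near ω D.carrier (D.pt 0)) (near ω D.carrier (D.pt 1))).map fun γ => γ.curve; let Q : (ℂ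 → ℝ) → Literature.Probability.RandomPlanarGeometry.DobrushinDomain → ℝ → MeasureTheory.Measure (Literature.Probability.RandomPlanarGeometry.CurveClass ℂ) := fun ρ D δ => (Pois (intens ρ δ)).bind (qlaw D); ∀ D : Literature.Probability.RandomPlanarGeometry.DobrushinDomain, ∃ Γ : (NNReal → ℝ) → Literature.Probability.RandomPlanarGeometry.CurveClass ℂ, Literature.Probability.RandomPlanarGeometry.IsSLECurve ((8 : NNReal) / 3) D Γ ∧ Literature.Probability.RandomPlanarGeometry.TendstoLaw (fun (_ : ℝ) (x : Literature.Probability.RandomPlanarGeometry.CurveClass ℂ) => x) (Q (fun _ => 1) D) Γ Literature.Probability.Process.preWienerMeasure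

/-- item stmt-CriticalPhenomena-16012 · assembly · rank 1 · open · by planner
sources: LawlerSchrammWerner2004SAW, Literature.Probability.RandomPlanarGeometry.SAW.aemeasurable_curve, Literature.Analysis.FunctionSpaces.existsUnique_isPoissonPointProcess_holds
[assembly] PVConvergence → SubstrateUniversality → the sub-problem statement SAWScalingLimit (two-ε
transfer), with the antecedent PVConvergence written out (the gate's render check blocks the by-name
reference); definitionally the sibling's AssemblyViaTransfer (stmt-CriticalPhenomena-6945,
`Iff.rfl`), whose attached candidate proof AssemblyVT.lean (refuter g42-21, rc 0, standard axioms)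
proves this item verbatim. -/
@[route_item "route-CriticalPhenomena-SAWPoissonSubstrate"]
def Assembly : Prop :=
  (∀ (Pois : MeasureTheory.Measure ℂ → MeasureTheory.Measure (Literature.Analysis.FunctionSpaces.PointConfig ℂ)), (∀ ν : MeasureTheory.Measure ℂ, MeasureTheory.IsLocallyFiniteMeasure ν → (∀ z : ℂ, ν {z} = 0) → Literature.Analysis.FunctionSpaces.IsPoissonPointProcess ν (Pois ν)) → let S : Literature.Analysis.FunctionSpaces.PointConfig ℂ → ℂ → Set ℂ := fun ω c => (ω : Set ℂ) ∩ Metric.sphere c (Metric.infDist c (ω : Set ℂ)); let vor : Literature.Analysis.FunctionSpaces.PointConfig ℂ → SimpleGraph ℂ := fun ω => SimpleGraph.fromRel fun c c' => 3 ≤ (S ω c).encard ∧ 3 ≤ (S ω c').encard ∧ (S ω c ∩ S ω c').encard = 2; let μ : ENNReal := essSup (fun ω => Filter.limsup (fun n : ℕ => (⨆ c : Metric.closedBall (0 : ℂ) 1, (Literature.Probability.RandomPlanarGeometry.SAW.sawCount (vor ω) (c : ℂ) n : ENNReal)) ^ (1 / (n : ℝ))) Filter.atTop) (Pois MeasureTheory.volume);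 let xc : ℝ := (μ.toReal)⁻¹; let near : Literature.Analysis.FunctionSpaces.PointConfig ℂ → Set ℂ → ℂ → ℂ := fun ω Ω z => Classical.epsilon fun v : ℂ => v ∈ Literature.Probability.RandomPlanarGeometry.SAW.embMeshDomain (vor ω) id Ω 1 ∧ ∀ w ∈ Literature.Probability.RandomPlanarGeometry.SAW.embMeshDomain (vor ω) id Ω 1, dist v z ≤ dist w z; let intens : (ℂ → ℝ) → ℝ → MeasureTheory.Measure ℂ := fun ρ δ => ENNReal.ofReal (δ⁻¹ ^ 2) • MeasureTheory.volume.withDensity fun z => ENNReal.ofReal (ρ z); let qlaw : Literature.Probability.RandomPlanarGeometry.DobrushinDomain → Literature.Analysis.FunctionSpaces.PointConfig ℂ → MeasureTheory.Measure (Literature.Probability.RandomPlanarGeometry.CurveClass ℂ) := fun D ω => (Literature.Probability.RandomPlanarGeometry.SAW.embLaw (vor ω) id D.carrier 1 xc (near ω D.carrier (D.pt 0)) (near ω D.carrier (D.pt 1))).map fun γ => γ.curve; let Q : (ℂ → ℝ) → Literature.Probability.RandomPlanarGeometry.DobrushinDomain → ℝ → MeasureTheory.Measure (Literature.Probability.RandomPlanarGeometry.CurveClass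 ℂ) := fun ρ D δ => (Pois (intens ρ δ)).bind (qlaw D); ∀ D : Literature.Probability.RandomPlanarGeometry.DobrushinDomain, ∃ Γ : (NNReal → ℝ) → Literature.Probability.RandomPlanarGeometry.CurveClass ℂ, Literature.Probability.RandomPlanarGeometry.IsSLECurve ((8 : NNReal) / 3) D Γ ∧ Literature.Probability.RandomPlanarGeometry.TendstoLaw (fun (_ : ℝ) (x : Literature.Probability.RandomPlanarGeometry.CurveClass ℂ) => x) (Q (fun _ => 1) D) Γ Literature.Probability.Process.preWienerMeasure) → SubstrateUniversality → SAWScalingLimit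

/-! D-0027 §2.1 — DECIDING THEOREM (planner-authored via `route open/edit --closes-file`; by planner-rchoice-CriticalPhenomena-SAWPoissonHo-11b4d6dd-0 2026-08-16T17:10:07Z):
its hypotheses are this route's items and its conclusion the sub-problem Statement (glue_lint), and it elaborates with this file. -/

@[closes "route-CriticalPhenomena-SAWPoissonSubstrate"] theorem closes (hU : SubstrateUniversality) (hPV : PVConvergence) : _root_.SAWScalingLimit := by
  -- CRUX-ONLY deciding theorem (rev 1): the two-ε transfer `PVConvergence → SubstrateUniversality →
  -- SAWScalingLimit` (the optional item `Assembly`, = the sibling's AssemblyViaTransfer up to `Iff.rfl`)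
  -- is PROVED inline here instead of being assumed, so both binders are cruxes.
  classical
  -- a Poisson functor: Kingman's existence theorem with Rényi uniqueness, proved in the tree
  -- (`Literature.Analysis.FunctionSpaces.existsUnique_isPoissonPointProcess_holds`); junk value 0 off the
  -- locally-finite atomless class, where the hypothesis of the items is void.
  have key : ∀ ν : MeasureTheory.Measure ℂ, ∃ P : MeasureTheory.Measure (Literature.Analysis.FunctionSpaces.PointConfig ℂ),
      MeasureTheory.IsLocallyFiniteMeasure ν → (∀ z : ℂ, ν {z} = 0) →
        Literature.Analysis.FunctionSpaces.IsPoissonPointProcess ν P := by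
    intro ν
    by_cases h : MeasureTheory.IsLocallyFiniteMeasure ν ∧ ∀ z : ℂ, ν {z} = 0
    · haveI := h.1
      obtain ⟨P, hP, -⟩ := Literature.Analysis.FunctionSpaces.existsUnique_isPoissonPointProcess_holds (E := ℂ) ν h.2
      exact ⟨P, fun _ _ => hP⟩
    · exact ⟨0, fun h1 h2 => (h ⟨h1, h2⟩).elim⟩
  choose Pois hPois using key
  intro D a b hab
  -- (PV): the annealed Poisson-honeycomb law in D converges in law to a chordal SLE(8/3) curve Γ
  obtain ⟨Γ, hΓ, hT⟩ := hPV Pois hPois D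
  refine ⟨Γ, hΓ, Filter.Eventually.of_forall fun δ =>
    Literature.Probability.RandomPlanarGeometry.SAW.aemeasurable_curve _ _ _ _, ?_⟩
  intro f
  -- (U): the δℤ² test integrals differ from the annealed Poisson-honeycomb ones by o(1); add the two limits
  have h1 := hU Pois hPois D a b hab f
  have h2 := hT f
  have h3 := h1.add h2
  simp only [sub_add_cancel, zero_add] at h3
  exact h3

end Summit.CriticalPhenomena.SAWScalingLimit.Theses.SAWPoissonSubstrate
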